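import Summits.BirchSwinnertonDyer.BirchSwinnertonDyer.Theorems.KatoDescentPotSupersingularWildUpperUnitTwistRecordsFlat55
import Summits.BirchSwinnertonDyer.BirchSwinnertonDyer.Theorems.KatoDescentPotSupersingularWildUpperUnitTwistRecordsFlat56
import HarnessLib

/-!
# Route `KatoDescentPotSupersingular` (rung K9, sub-rung B5 = O6 wild `p = 3`, cell `bsd-potss`): `BSD₃` OF THE PAIR `(E, 3)` for the
# U₀-ns ♭ rows whose own `#Ш_an(E)` is a `3`-adic unit — corollaries of the landed unit-twist KERNEL RECORDS (part 14: 447174cu1@3, 475200co1@3, 487350bv1@3, 89856bs1@3, 487350ch1@3)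
# (seat `bsd-potss-k9-c4` g16; `--supports stmt-BirchSwinnertonDyer-19197 --as helper`)

HONEST FRAMING. THEOREMS ONLY; PER PAIR — NOT a class theorem; nothing is booked by this file (booking is the referees' word on the
b2b residue lane); items 19189 / 19197 stay OPEN at class level; BSD is not proved for any CLASS by this.  For each listed row the
landed record `WildUpperUnitTwistRecords.missingUpperBoundAt_g<label>_3` (files `…WildUpperUnitTwistRecordsFlatNN`, this seat) gives
the UPPER half `ord₃ #Ш(E) ≤ ord₃ #Ш(E)_an` from PUBLISHED inputs (Matar–Nekovář 2019 Thm 0.3, Gross–Zagier, Kolyvagin, GZK,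
modularity — displayed `hGZ hKo hMN hGZK hmod`) + the displayed datum/numerics; when moreover `#Ш(E)_an` is a `3`-adic UNIT
(displayed: `hsha : shaAn W = q₀`, `hv₀ : ord₃ q₀ ≤ 0` — Cremona's `#Ш_an = 1` on every row here, b2b O6 class list `ord_p_sha = 0`)
the LOWER half is trivial and `Typed.missingPPartAt_of_lower_of_upper` + `Typed.bsdp_of_missingPPartAt` (GZK for `rank = r_an`, `Ш`
finite) give Miller's `BSD(E,3)` = `BSDp W 3`.  Exactly kmc g21's F15 §2 shape
(`AdditiveUnitTwistCertificate.bsdp_rankZero_irreducible_of_unitShaAn_at_unitTwistDatum_of_matarNekovar`, p574309) in record-input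
form.  CONDITIONAL on every displayed hypothesis; the numerics (`r_an`, `#Ш_an` of `E` and of the twist) are EVIDENCE (Cremona's
tables / kit j297595, j297596, j297999 of this seat), not kernel facts.  These are the «F15-bookable pairs» of kmc g21's FINDING
(HOME/bsd-potss-kmc/g21) on the K9 side, now as kernel theorems; whether and at what tier a pair is booked is the residue lane's /
referees' decision, not this file's.

References: [MatarNekovar2019] Thm. 0.3, §0.11; [GrossZagier1986] I.6.3, V.§2; [KolyvaginEulerSystems1990] Thm. A; [Miller2011LMS]
§1, Def. 1.1; [Darmon2004] Thm. 3.22; [Cremona2006] Table 1 and Table 4.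
-/

set_option autoImplicit false
set_option linter.dupNamespace false
noncomputable section
open scoped Classical NumberField
open WeierstrassCurve NumberField Field
  Literature.NumberTheory.EllipticCurves
  Literature.NumberTheory.EllipticCurves.ModularForms Literature.NumberTheory.EllipticCurves.Rank1Residual
  Literature.NumberTheory.EllipticCurves.Rank1Residual.Typed Literature.NumberTheory.Automorphic
  Summit.BirchSwinnertonDyer.Rank1Residual Summit.BirchSwinnertonDyer.Rank1Residual.Additive
  Summit.BirchSwinnertonDyer.BirchSwinnertonDyer.Theorems

namespace Summit.BirchSwinnertonDyer.BirchSwinnertonDyer.Theorems.WildUpperUnitTwistRecords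

/-- **`BSD(E,3)` (Miller) for the PAIR `E = 447174cu1`, `p = 3`** — O6 wild `3`, U₀-ns ♭ row, `E[3]` irreducible, `r_an = 0`,
Cremona `#Ш(E)_an = 1` (a `3`-adic unit, DISPLAYED as `hsha`/`hv₀`): from the landed record `missingUpperBoundAt_g447174cu1_3`
(upper half ⟸ MN19 0.3 + GZ + Kolyvagin + GZK + modularity + the unit rank-one twist `d_K = -887`, all displayed) the lower half is
trivial and GZK closes Miller's `BSD(E,3)`.  CONDITIONAL on the displayed hypotheses; per pair; books nothing by itself.
[cite: Miller2011LMS, §1 and Def. 1.1] [cite: MatarNekovar2019, Thm. 0.3 (p. 456)] [cite: Cremona2006, Table 4 (Cremona label 447174cu1)] -/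
theorem bsdp_g447174cu1_3
    (hGZ : ∀ (N : ℕ) [NeZero N] (W : WeierstrassCurve ℚ) (K : Type) [Field K] [NumberField K],
      gross_zagier N W K)
    (hKo : ∀ (N : ℕ) [NeZero N] (W : WeierstrassCurve ℚ) (K : Type) [Field K] [NumberField K],
      kolyvagin N W K)
    (hMN : ∀ (N : ℕ) [NeZero N] (W : WeierstrassCurve ℚ) (K : Type) [Field K] [NumberField K],
      MatarNekovar2019.thm03_padicValNat_card_sha_le_of_irreducible N W K)
    (hGZK : rank_eq_analyticRank_of_analyticRank_le_one) (hmod : hasEntireLFunction_rat)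
    {W : WeierstrassCurve ℚ} [W.IsElliptic] [W.IsGloballyMinimal] (hWeq : W = (⟨1, (-1), 0, (-31719), 1713557⟩ : WeierstrassCurve ℚ))
    (hN : W.conductorNorm ℤ = 447174) (hr : W.analyticRank = 0) (htam : ¬ 3 ∣ W.tamagawaProduct)
    (D : ModularParametrizationData W 447174) (hc : ¬ (3 : ℤ) ∣ D.c)
    (K : Type) [Field K] [NumberField K] (hK : IsImaginaryQuadratic K) (hdK : NumberField.discr K = -887)
    {Wd : WeierstrassCurve ℚ} [Wd.IsElliptic] [Wd.IsGloballyMinimal] (hWdeq : Wd = (⟨1, (-1), 0, (-24955673430), (-1190289770146996)⟩ : WeierstrassCurve ℚ))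
    (hrd : Wd.analyticRank = 1) {qd : ℚ} (hqd : shaAn Wd = (qd : ℂ)) (hvd : padicValRat 3 qd ≤ 0)
    {q₀ : ℚ} (hsha : shaAn W = (q₀ : ℂ)) (hv₀ : padicValRat 3 q₀ ≤ 0) :
    BSDp W 3 :=
  bsdp_of_missingPPartAt W 3 hGZK (by rw [hr]; exact zero_le_one)
    (missingPPartAt_of_lower_of_upper W 3 ⟨q₀, hsha, le_trans hv₀ (by exact_mod_cast Nat.zero_le _)⟩
      (missingUpperBoundAt_g447174cu1_3 hGZ hKo hMN hGZK hmod hWeq hN hr htam D hc K hK hdK hWdeq hrd hqd hvd))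

/-- **`BSD(E,3)` (Miller) for the PAIR `E = 475200co1`, `p = 3`** — O6 wild `3`, U₀-ns ♭ row, `E[3]` irreducible, `r_an = 0`,
Cremona `#Ш(E)_an = 1` (a `3`-adic unit, DISPLAYED as `hsha`/`hv₀`): from the landed record `missingUpperBoundAt_g475200co1_3`
(upper half ⟸ MN19 0.3 + GZ + Kolyvagin + GZK + modularity + the unit rank-one twist `d_K = -959`, all displayed) the lower half is
trivial and GZK closes Miller's `BSD(E,3)`.  CONDITIONAL on the displayed hypotheses; per pair; books nothing by itself.
[cite: Miller2011LMS, §1 and Def. 1.1] [cite: MatarNekovar2019, Thm. 0.3 (p. 456)] [cite: Cremona2006, Table 4 (Cremona label 475200co1)] -/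
theorem bsdp_g475200co1_3
    (hGZ : ∀ (N : ℕ) [NeZero N] (W : WeierstrassCurve ℚ) (K : Type) [Field K] [NumberField K],
      gross_zagier N W K)
    (hKo : ∀ (N : ℕ) [NeZero N] (W : WeierstrassCurve ℚ) (K : Type) [Field K] [NumberField K],
      kolyvagin N W K)
    (hMN : ∀ (N : ℕ) [NeZero N] (W : WeierstrassCurve ℚ) (K : Type) [Field K] [NumberField K],
      MatarNekovar2019.thm03_padicValNat_card_sha_le_of_irreducible N W K)
    (hGZK : rank_eq_analyticRank_of_analyticRank_le_one) (hmod : hasEntireLFunction_rat)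
    {W : WeierstrassCurve ℚ} [W.IsElliptic] [W.IsGloballyMinimal] (hWeq : W = (⟨0, 0, 0, (-9750), 356250⟩ : WeierstrassCurve ℚ))
    (hN : W.conductorNorm ℤ = 475200) (hr : W.analyticRank = 0) (htam : ¬ 3 ∣ W.tamagawaProduct)
    (D : ModularParametrizationData W 475200) (hc : ¬ (3 : ℤ) ∣ D.c)
    (K : Type) [Field K] [NumberField K] (hK : IsImaginaryQuadratic K) (hdK : NumberField.discr K = -959)
    {Wd : WeierstrassCurve ℚ} [Wd.IsElliptic] [Wd.IsGloballyMinimal] (hWdeq : Wd = (⟨0, 0, 0, (-8966889750), (-314203265643750)⟩ : WeierstrassCurve ℚ))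
    (hrd : Wd.analyticRank = 1) {qd : ℚ} (hqd : shaAn Wd = (qd : ℂ)) (hvd : padicValRat 3 qd ≤ 0)
    {q₀ : ℚ} (hsha : shaAn W = (q₀ : ℂ)) (hv₀ : padicValRat 3 q₀ ≤ 0) :
    BSDp W 3 :=
  bsdp_of_missingPPartAt W 3 hGZK (by rw [hr]; exact zero_le_one)
    (missingPPartAt_of_lower_of_upper W 3 ⟨q₀, hsha, le_trans hv₀ (by exact_mod_cast Nat.zero_le _)⟩
      (missingUpperBoundAt_g475200co1_3 hGZ hKo hMN hGZK hmod hWeq hN hr htam D hc K hK hdK hWdeq hrd hqd hvd))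

/-- **`BSD(E,3)` (Miller) for the PAIR `E = 487350bv1`, `p = 3`** — O6 wild `3`, U₀-ns ♭ row, `E[3]` irreducible, `r_an = 0`,
Cremona `#Ш(E)_an = 1` (a `3`-adic unit, DISPLAYED as `hsha`/`hv₀`): from the landed record `missingUpperBoundAt_g487350bv1_3`
(upper half ⟸ MN19 0.3 + GZ + Kolyvagin + GZK + modularity + the unit rank-one twist `d_K = -911`, all displayed) the lower half is
trivial and GZK closes Miller's `BSD(E,3)`.  CONDITIONAL on the displayed hypotheses; per pair; books nothing by itself.
[cite: Miller2011LMS, §1 and Def. 1.1] [cite: MatarNekovar2019, Thm. 0.3 (p. 456)] [cite: Cremona2006, Table 4 (Cremona label 487350bv1)] -/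
theorem bsdp_g487350bv1_3
    (hGZ : ∀ (N : ℕ) [NeZero N] (W : WeierstrassCurve ℚ) (K : Type) [Field K] [NumberField K],
      gross_zagier N W K)
    (hKo : ∀ (N : ℕ) [NeZero N] (W : WeierstrassCurve ℚ) (K : Type) [Field K] [NumberField K],
      kolyvagin N W K)
    (hMN : ∀ (N : ℕ) [NeZero N] (W : WeierstrassCurve ℚ) (K : Type) [Field K] [NumberField K],
      MatarNekovar2019.thm03_padicValNat_card_sha_le_of_irreducible N W K)
    (hGZK : rank_eq_analyticRank_of_analyticRank_le_one) (hmod : hasEntireLFunction_rat)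
    {W : WeierstrassCurve ℚ} [W.IsElliptic] [W.IsGloballyMinimal] (hWeq : W = (⟨1, (-1), 0, 2835768, 2036269376⟩ : WeierstrassCurve ℚ))
    (hN : W.conductorNorm ℤ = 487350) (hr : W.analyticRank = 0) (htam : ¬ 3 ∣ W.tamagawaProduct)
    (D : ModularParametrizationData W 487350) (hc : ¬ (3 : ℤ) ∣ D.c)
    (K : Type) [Field K] [NumberField K] (hK : IsImaginaryQuadratic K) (hdK : NumberField.discr K = -911)
    {Wd : WeierstrassCurve ℚ} [Wd.IsElliptic] [Wd.IsGloballyMinimal] (hWdeq : Wd = (⟨1, (-1), 0, 2353463258718, (-1540074404638959724)⟩ : WeierstrassCurve ℚ))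
    (hrd : Wd.analyticRank = 1) {qd : ℚ} (hqd : shaAn Wd = (qd : ℂ)) (hvd : padicValRat 3 qd ≤ 0)
    {q₀ : ℚ} (hsha : shaAn W = (q₀ : ℂ)) (hv₀ : padicValRat 3 q₀ ≤ 0) :
    BSDp W 3 :=
  bsdp_of_missingPPartAt W 3 hGZK (by rw [hr]; exact zero_le_one)
    (missingPPartAt_of_lower_of_upper W 3 ⟨q₀, hsha, le_trans hv₀ (by exact_mod_cast Nat.zero_le _)⟩
      (missingUpperBoundAt_g487350bv1_3 hGZ hKo hMN hGZK hmod hWeq hN hr htam D hc K hK hdK hWdeq hrd hqd hvd))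

/-- **`BSD(E,3)` (Miller) for the PAIR `E = 89856bs1`, `p = 3`** — O6 wild `3`, U₀-ns ♭ row, `E[3]` irreducible, `r_an = 0`,
Cremona `#Ш(E)_an = 4` (a `3`-adic unit, DISPLAYED as `hsha`/`hv₀`): from the landed record `missingUpperBoundAt_g89856bs1_3`
(upper half ⟸ MN19 0.3 + GZ + Kolyvagin + GZK + modularity + the unit rank-one twist `d_K = -23`, all displayed) the lower half is
trivial and GZK closes Miller's `BSD(E,3)`.  CONDITIONAL on the displayed hypotheses; per pair; books nothing by itself.
[cite: Miller2011LMS, §1 and Def. 1.1] [cite: MatarNekovar2019, Thm. 0.3 (p. 456)] [cite: Cremona2006, Table 4 (Cremona label 89856bs1)] -/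
theorem bsdp_g89856bs1_3
    (hGZ : ∀ (N : ℕ) [NeZero N] (W : WeierstrassCurve ℚ) (K : Type) [Field K] [NumberField K],
      gross_zagier N W K)
    (hKo : ∀ (N : ℕ) [NeZero N] (W : WeierstrassCurve ℚ) (K : Type) [Field K] [NumberField K],
      kolyvagin N W K)
    (hMN : ∀ (N : ℕ) [NeZero N] (W : WeierstrassCurve ℚ) (K : Type) [Field K] [NumberField K],
      MatarNekovar2019.thm03_padicValNat_card_sha_le_of_irreducible N W K)
    (hGZK : rank_eq_analyticRank_of_analyticRank_le_one) (hmod : hasEntireLFunction_rat)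
    {W : WeierstrassCurve ℚ} [W.IsElliptic] [W.IsGloballyMinimal] (hWeq : W = (⟨0, 0, 0, (-151038), 16219440⟩ : WeierstrassCurve ℚ))
    (hN : W.conductorNorm ℤ = 89856) (hr : W.analyticRank = 0) (htam : ¬ 3 ∣ W.tamagawaProduct)
    (D : ModularParametrizationData W 89856) (hc : ¬ (3 : ℤ) ∣ D.c)
    (K : Type) [Field K] [NumberField K] (hK : IsImaginaryQuadratic K) (hdK : NumberField.discr K = -23)
    {Wd : WeierstrassCurve ℚ} [Wd.IsElliptic] [Wd.IsGloballyMinimal] (hWdeq : Wd = (⟨0, 0, 0, (-79899102), (-197341926480)⟩ : WeierstrassCurve ℚ))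
    (hrd : Wd.analyticRank = 1) {qd : ℚ} (hqd : shaAn Wd = (qd : ℂ)) (hvd : padicValRat 3 qd ≤ 0)
    {q₀ : ℚ} (hsha : shaAn W = (q₀ : ℂ)) (hv₀ : padicValRat 3 q₀ ≤ 0) :
    BSDp W 3 :=
  bsdp_of_missingPPartAt W 3 hGZK (by rw [hr]; exact zero_le_one)
    (missingPPartAt_of_lower_of_upper W 3 ⟨q₀, hsha, le_trans hv₀ (by exact_mod_cast Nat.zero_le _)⟩
      (missingUpperBoundAt_g89856bs1_3 hGZ hKo hMN hGZK hmod hWeq hN hr htam D hc K hK hdK hWdeq hrd hqd hvd))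

/-- **`BSD(E,3)` (Miller) for the PAIR `E = 487350ch1`, `p = 3`** — O6 wild `3`, U₀-ns ♭ row, `E[3]` irreducible, `r_an = 0`,
Cremona `#Ш(E)_an = 1` (a `3`-adic unit, DISPLAYED as `hsha`/`hv₀`): from the landed record `missingUpperBoundAt_g487350ch1_3`
(upper half ⟸ MN19 0.3 + GZ + Kolyvagin + GZK + modularity + the unit rank-one twist `d_K = -839`, all displayed) the lower half is
trivial and GZK closes Miller's `BSD(E,3)`.  CONDITIONAL on the displayed hypotheses; per pair; books nothing by itself.
[cite: Miller2011LMS, §1 and Def. 1.1] [cite: MatarNekovar2019, Thm. 0.3 (p. 456)] [cite: Cremona2006, Table 4 (Cremona label 487350ch1)] -/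
theorem bsdp_g487350ch1_3
    (hGZ : ∀ (N : ℕ) [NeZero N] (W : WeierstrassCurve ℚ) (K : Type) [Field K] [NumberField K],
      gross_zagier N W K)
    (hKo : ∀ (N : ℕ) [NeZero N] (W : WeierstrassCurve ℚ) (K : Type) [Field K] [NumberField K],
      kolyvagin N W K)
    (hMN : ∀ (N : ℕ) [NeZero N] (W : WeierstrassCurve ℚ) (K : Type) [Field K] [NumberField K],
      MatarNekovar2019.thm03_padicValNat_card_sha_le_of_irreducible N W K)
    (hGZK : rank_eq_analyticRank_of_analyticRank_le_one) (hmod : hasEntireLFunction_rat)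
    {W : WeierstrassCurve ℚ} [W.IsElliptic] [W.IsGloballyMinimal] (hWeq : W = (⟨1, (-1), 0, 7877133, (-9432424459)⟩ : WeierstrassCurve ℚ))
    (hN : W.conductorNorm ℤ = 487350) (hr : W.analyticRank = 0) (htam : ¬ 3 ∣ W.tamagawaProduct)
    (D : ModularParametrizationData W 487350) (hc : ¬ (3 : ℤ) ∣ D.c)
    (K : Type) [Field K] [NumberField K] (hK : IsImaginaryQuadratic K) (hdK : NumberField.discr K = -839)
    {Wd : WeierstrassCurve ℚ} [Wd.IsElliptic] [Wd.IsGloballyMinimal] (hWdeq : Wd = (⟨1, (-1), 0, 5544879206508, 5569528486086942416⟩ : WeierstrassCurve ℚ))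
    (hrd : Wd.analyticRank = 1) {qd : ℚ} (hqd : shaAn Wd = (qd : ℂ)) (hvd : padicValRat 3 qd ≤ 0)
    {q₀ : ℚ} (hsha : shaAn W = (q₀ : ℂ)) (hv₀ : padicValRat 3 q₀ ≤ 0) :
    BSDp W 3 :=
  bsdp_of_missingPPartAt W 3 hGZK (by rw [hr]; exact zero_le_one)
    (missingPPartAt_of_lower_of_upper W 3 ⟨q₀, hsha, le_trans hv₀ (by exact_mod_cast Nat.zero_le _)⟩
      (missingUpperBoundAt_g487350ch1_3 hGZ hKo hMN hGZK hmod hWeq hN hr htam D hc K hK hdK hWdeq hrd hqd hvd))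

end Summit.BirchSwinnertonDyer.BirchSwinnertonDyer.Theorems.WildUpperUnitTwistRecords

end
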